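import Literature.Computability.Complexity.TVBlockBricks
import HarnessLib

/-!
# `FP` bricks for Trevisan–Vadhan's oracle machine, III: the clause and matrix folds

Literature / complexity — derandomization (Case 2 of IW98 in TV07 form), third machine layer (sequel of
`TVFieldBricks.lean`, `TVBlockBricks.lean`). The value of the last member `f_{n,m(n)}` of the family —
the universal MATRIX — at a point is the double product `Π_j (1 + Π_k litFactor_{jk})` (`TVMatrixStr.lean`:
`matrixStr`, `matrixStr_eq_bits_eval`); here it is computed by two nested counted folds (`Brick.foldLoop`
with the multiplication `fmulOpF` modulo the carried modulus, exactly as the indicator fold `deltaF` of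
`HardLangMachine.lean`). Records: the context `X = ⟨P, ⟨1ⁿ, f⟩⟩` (point bits with any tail, `1ⁿ`, the
modulus `f = modStr M`), the clause context `Y = ⟨X, 1ʲ⟩`, the literal context `W = ⟨Y, 1ᵏ⟩`:

* readers and `TVBrick.oneFrom F` (the constant `1` built from a modulus read by `F`);
* `TVBrick.litPieceF` on `W`: `⟨litFactorStr (y_{jk}) (x_k) (z_{jk}), f⟩` (`litPieceF_apply`: blocks located
  by `idxY/idxX/idxZ`, read by `blockAt`, combined by `litF`);
* `TVBrick.clauseProdF`, `TVBrick.clauseF` on `Y` (inner fold over `k < n`; `clauseF_apply = clauseStr`);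
* `TVBrick.clausePieceF`, **`TVBrick.matrixF`** on `X` (outer fold over `j < n`) with `matrixF_mem_FP` and
  **`matrixF_apply`**: on `⟨ptBits n x ++ tail, ⟨1ⁿ, modStr (Mof n)⟩⟩` the value is
  `bits (Mof n) (eval x (matrixPoly (K n) n))` — "`f_{n,m(n)}` can be evaluated in time poly(n)"
  (TV07 Lemma 4.1 (i)), as an `FP` string function.

Everything is proved; definitions are `FP` string functions (no named facts).

## References

* [TrevisanVadhan2007] L. Trevisan, S. Vadhan, Comput. Complexity 16 (2007), Lemma 4.1 (i), Thm. 4.3.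
* [AroraBarakCC2009] S. Arora, B. Barak, CUP 2009, §1.3 (bounded loops, composition).
-/

noncomputable section

namespace Literature.Computability.Complexity

namespace TVBrick

open _root_.Computability Polynomial Brick Plumb GF2Str HardLangM QBFUniv Finset
  Literature.InformationTheory.Coding

/-! ### The constant `1` from a modulus reader -/

/-- `1 = 1 0^M` built from the modulus read by `F` (`|F w| = M + 2`). [folklore] -/
def oneFrom (F : List Bool → List Bool) : List Bool → List Bool :=
  appF ∘ fanoutFn (fun _ => [true]) (Kannan.zerosFn ∘ dropFn ∘ fanoutFn (fun _ => [true, true]) F)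

/-- `oneFrom F ∈ FP`. [folklore] -/
theorem oneFrom_mem_FP {F : List Bool → List Bool} (hF : F ∈ FP) : oneFrom F ∈ FP :=
  comp_mem_FP appF_mem_FP (fanoutFn_mem_FP (const_mem_FP _) (comp_mem_FP Kannan.zerosFn_mem_FP
    (comp_mem_FP dropFn_mem_FP (fanoutFn_mem_FP (const_mem_FP _) hF))))

/-- Value of `oneFrom`. [folklore] -/
theorem oneFrom_apply (M : ℕ) {F : List Bool → List Bool} {w : List Bool} (h : F w = modStr M) : oneFrom F w = bits M 1 := by
  simp only [oneFrom, Function.comp_apply, fanoutFn_apply, h, dropFn_boolPair, Kannan.zerosFn_apply, List.length_drop,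
    (modStr_top M).1, appF_boolPair, List.length_cons, List.length_nil, List.singleton_append, bits_one]
  rw [show M + 1 + 1 - (0 + 1 + 1) = M by omega]

/-! ### Readers of the literal context `W = ⟨⟨⟨P, ⟨1ⁿ, f⟩⟩, 1ʲ⟩, 1ᵏ⟩` -/

/-- `P` of `W`. [folklore] -/
def wP : List Bool → List Bool := fstF ∘ fstF ∘ fstF
/-- `1ⁿ` of `W`. [folklore] -/
def wN : List Bool → List Bool := fstF ∘ sndF ∘ fstF ∘ fstF
/-- `f` of `W`. [folklore] -/
def wF : List Bool → List Bool := sndF ∘ sndF ∘ fstF ∘ fstF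
/-- `1ʲ` of `W`. [folklore] -/
def wJ : List Bool → List Bool := sndF ∘ fstF
/-- `1ᵏ` of `W`. [folklore] -/
def wK : List Bool → List Bool := sndF
/-- `⟨1ⁿ, ⟨1ʲ, 1ᵏ⟩⟩` of `W` (the input of the index bricks). [folklore] -/
def wNJK : List Bool → List Bool := fanoutFn wN (fanoutFn wJ wK)

/-- The readers are in `FP`. [folklore] -/
theorem w_mem_FP : wP ∈ FP ∧ wN ∈ FP ∧ wF ∈ FP ∧ wJ ∈ FP ∧ wK ∈ FP ∧ wNJK ∈ FP := by
  have hP : wP ∈ FP := comp_mem_FP fstF_mem_FP (comp_mem_FP fstF_mem_FP fstF_mem_FP)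
  have hN : wN ∈ FP := comp_mem_FP fstF_mem_FP (comp_mem_FP sndF_mem_FP (comp_mem_FP fstF_mem_FP fstF_mem_FP))
  have hF : wF ∈ FP := comp_mem_FP sndF_mem_FP (comp_mem_FP sndF_mem_FP (comp_mem_FP fstF_mem_FP fstF_mem_FP))
  have hJ : wJ ∈ FP := comp_mem_FP sndF_mem_FP fstF_mem_FP
  have hK : wK ∈ FP := sndF_mem_FP
  exact ⟨hP, hN, hF, hJ, hK, fanoutFn_mem_FP hN (fanoutFn_mem_FP hJ hK)⟩

/-- The context of a point. [folklore] -/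
def ctxX (P : List Bool) (n : ℕ) (f : List Bool) : List Bool := boolPair P (boolPair (ones n) f)

/-- Values of the readers on `W = ⟨⟨ctxX P n f, 1ʲ⟩, 1ᵏ⟩`. [folklore] -/
theorem w_apply (P f : List Bool) (n j k : ℕ) :
    let W := boolPair (boolPair (ctxX P n f) (ones j)) (ones k)
    wP W = P ∧ wN W = ones n ∧ wF W = f ∧ wJ W = ones j ∧ wK W = ones k ∧
      wNJK W = boolPair (ones n) (boolPair (ones j) (ones k)) := by
  simp [wP, wN, wF, wJ, wK, wNJK, ctxX]

/-! ### The literal piece -/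

/-- Block of `P` at the index computed by `idx` from `⟨1ⁿ, ⟨1ʲ, 1ᵏ⟩⟩`. [folklore] -/
def blkOf (idx : List Bool → List Bool) : List Bool → List Bool :=
  blockAt ∘ fanoutFn wP (fanoutFn (idx ∘ wNJK) wF)

/-- `blkOf idx ∈ FP`. [folklore] -/
theorem blkOf_mem_FP {idx : List Bool → List Bool} (h : idx ∈ FP) : blkOf idx ∈ FP :=
  comp_mem_FP blockAt_mem_FP (fanoutFn_mem_FP w_mem_FP.1 (fanoutFn_mem_FP (comp_mem_FP h w_mem_FP.2.2.2.2.2) w_mem_FP.2.2.1))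

/-- **The literal piece** on `W`: `⟨litFactorStr y_{jk} x_k z_{jk}, f⟩`. [cite: TrevisanVadhan2007, Lemma 4.1 (i)] -/
def litPieceF : List Bool → List Bool :=
  fanoutFn (litF ∘ fanoutFn (fanoutFn (blkOf idxY) (fanoutFn (blkOf idxX) (blkOf idxZ))) wF) wF

/-- `litPieceF ∈ FP`. [folklore] -/
theorem litPieceF_mem_FP : litPieceF ∈ FP :=
  fanoutFn_mem_FP (comp_mem_FP litF_mem_FP (fanoutFn_mem_FP
    (fanoutFn_mem_FP (blkOf_mem_FP idx_mem_FP.1) (fanoutFn_mem_FP (blkOf_mem_FP idx_mem_FP.2.2.1) (blkOf_mem_FP idx_mem_FP.2.1)))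
    w_mem_FP.2.2.1)) w_mem_FP.2.2.1

/-- Value of a located block on a genuine context. [folklore] -/
theorem blkOf_apply (n : ℕ) (x : Fin (N n) → K n) (tail : List Bool) (j k : Fin n) {idx : List Bool → List Bool}
    {v : Fin (N n)} (hidx : idx (boolPair (ones n) (boolPair (ones j.val) (ones k.val))) = ones v.val) :
    blkOf idx (boolPair (boolPair (ctxX (ptBits n x ++ tail) n (modStr (Mof n))) (ones j.val)) (ones k.val)) =
      bits (Mof n) (x v) := by
  obtain ⟨hP, -, hF, -, -, hNJK⟩ := w_apply (ptBits n x ++ tail) (modStr (Mof n)) n j.val k.val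
  rw [blkOf, Function.comp_apply, fanoutFn_apply, fanoutFn_apply, Function.comp_apply, hP, hNJK, hF, hidx]
  exact blockAt_ptBits n x v tail

/-- **Value of the literal piece** on a genuine context. [cite: TrevisanVadhan2007, Lemma 4.1 (i)] -/
theorem litPieceF_apply (n : ℕ) (x : Fin (N n) → K n) (tail : List Bool) (j k : Fin n) :
    litPieceF (boolPair (boolPair (ctxX (ptBits n x ++ tail) n (modStr (Mof n))) (ones j.val)) (ones k.val)) =
      boolPair (litFactorStr (Mof n) (bits (Mof n) (x (lay n (.y j k)))) (bits (Mof n) (x (lay n (.x k))))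
        (bits (Mof n) (x (lay n (.z j k))))) (modStr (Mof n)) := by
  obtain ⟨-, -, hF, -, -, -⟩ := w_apply (ptBits n x ++ tail) (modStr (Mof n)) n j.val k.val
  obtain ⟨hY, hZ, hX, -⟩ := idx_apply n j.val k.val
  have h1 := blkOf_apply n x tail j k (idx := idxY) (v := lay n (.y j k)) (by rw [hY, lay_y_val])
  have h2 := blkOf_apply n x tail j k (idx := idxX) (v := lay n (.x k)) (by rw [hX, lay_x_val])
  have h3 := blkOf_apply n x tail j k (idx := idxZ) (v := lay n (.z j k)) (by rw [hZ, lay_z_val])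
  rw [litPieceF, fanoutFn_apply, Function.comp_apply, fanoutFn_apply, fanoutFn_apply, fanoutFn_apply, h1, h2, h3, hF,
    litF_apply]

/-- Length of a field product string: `M + 1`. [folklore] -/
theorem length_fmulStr (M : ℕ) (a b : List Bool) : (fmulStr M a b).length = M + 1 := by
  rw [fmulStr, length_pmodStr _ _ (modStr_top M).1]

/-- Length of the literal piece on a genuine context: `3M + 6`. [folklore] -/
theorem length_litPieceF (n : ℕ) (x : Fin (N n) → K n) (tail : List Bool) (j k : Fin n) :
    (litPieceF (boolPair (boolPair (ctxX (ptBits n x ++ tail) n (modStr (Mof n))) (ones j.val)) (ones k.val))).length =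
      3 * Mof n + 6 := by
  rw [litPieceF_apply, length_boolPair, litFactorStr, length_fmulStr, (modStr_top _).1]; ring

/-! ### The inner fold: the clause -/

/-- `1ⁿ` of the clause context `Y = ⟨⟨P, ⟨1ⁿ, f⟩⟩, 1ʲ⟩`. [folklore] -/
def yN : List Bool → List Bool := fstF ∘ sndF ∘ fstF
/-- `f` of the clause context `Y`. [folklore] -/
def yF : List Bool → List Bool := sndF ∘ sndF ∘ fstF

/-- Initialisation of the inner fold: `⟨Y, ⟨encodeNat n, ⟨1⁰, 1⟩⟩⟩`. [folklore] -/
def initY : List Bool → List Bool :=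
  fanoutFn (fun w => w) (fanoutFn (lenBinF ∘ yN) (fanoutFn (fun _ => []) (oneFrom yF)))

/-- `initY ∈ FP`. [folklore] -/
theorem initY_mem_FP : initY ∈ FP :=
  fanoutFn_mem_FP (PolyTimeComputable.id _) (fanoutFn_mem_FP (comp_mem_FP lenBinF_mem_FP
    (comp_mem_FP fstF_mem_FP (comp_mem_FP sndF_mem_FP fstF_mem_FP)))
    (fanoutFn_mem_FP (const_mem_FP _) (oneFrom_mem_FP (comp_mem_FP sndF_mem_FP (comp_mem_FP sndF_mem_FP fstF_mem_FP)))))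

/-- Value of `initY`. [folklore] -/
theorem initY_apply (M : ℕ) (P : List Bool) (n j : ℕ) :
    initY (boolPair (ctxX P n (modStr M)) (ones j)) =
      boolPair (boolPair (ctxX P n (modStr M)) (ones j)) (boolPair (encodeNat n) (boolPair (ones 0) (bits M 1))) := by
  have hF : yF (boolPair (ctxX P n (modStr M)) (ones j)) = modStr M := by simp [yF, ctxX]
  simp only [initY, fanoutFn_apply, Function.comp_apply, lenBinF_apply, oneFrom_apply M hF]
  simp [yN, ctxX, ones]

/-- **The clause product** `Π_{k<n} litFactor_{jk}` on `Y`: the inner counted fold. [cite: TrevisanVadhan2007, Lemma 4.1 (i)] -/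
def clauseProdF : List Bool → List Bool := sndPow 2 ∘ foldLoop fmulOpF (clipF 3 litPieceF) X ∘ initY

/-- `clauseProdF ∈ FP`. [folklore] -/
theorem clauseProdF_mem_FP : clauseProdF ∈ FP :=
  comp_mem_FP (sndPow_mem_FP 2) (comp_mem_FP
    (foldLoop_clipF_mem_FP 3 fmulOpF_mem_FP length_fmulOpF_le litPieceF_mem_FP _) initY_mem_FP)

/-- The `ℕ`-indexed literal strings of clause `j` (junk beyond `n`). [folklore] -/
def litStrs (n : ℕ) (x : Fin (N n) → K n) (j k : ℕ) : List Bool :=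
  litFactorStr (Mof n) (bits (Mof n) (coordY n x j k)) (bits (Mof n) (coordX n x k)) (bits (Mof n) (coordZ n x j k))

/-- In range, the literal strings are those of the layout. [folklore] -/
theorem litStrs_eq (n : ℕ) (x : Fin (N n) → K n) (j k : ℕ) (hj : j < n) (hk : k < n) :
    litStrs n x j k = litFactorStr (Mof n) (bits (Mof n) (x (lay n (.y ⟨j, hj⟩ ⟨k, hk⟩)))) (bits (Mof n) (x (lay n (.x ⟨k, hk⟩))))
      (bits (Mof n) (x (lay n (.z ⟨j, hj⟩ ⟨k, hk⟩)))) := by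
  simp [litStrs, coordY, coordX, coordZ, hj, hk]

/-- **Value of the clause product.** [cite: TrevisanVadhan2007, Lemma 4.1 (i)] -/
theorem clauseProdF_apply (n : ℕ) (x : Fin (N n) → K n) (tail : List Bool) (j : Fin n) :
    clauseProdF (boolPair (ctxX (ptBits n x ++ tail) n (modStr (Mof n))) (ones j.val)) = prodStr (Mof n) (litStrs n x j.val) n := by
  set Y := boolPair (ctxX (ptBits n x ++ tail) n (modStr (Mof n))) (ones j.val) with hYdef
  have hk : n ≤ (X : Polynomial ℕ).eval Y.length := by
    simp only [eval_X, hYdef, ctxX, length_boolPair, ones, List.length_replicate]; omega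
  have hloop := foldLoop_apply fmulOpF (clipF 3 litPieceF) hk 0 (bits (Mof n) 1)
  rw [clauseProdF, Function.comp_apply, Function.comp_apply, initY_apply, hloop, sndPow_succ_boolPair, sndPow_succ_boolPair,
    sndPow_zero_boolPair, foldAcc_clipF (fun k _ hk' => ?_)]
  · rw [foldAcc_eq_foldl fmulOpF litPieceF Y (fun acc p => fmulStr (Mof n) acc (fstF p))
      (fun k => litPieceF (boolPair Y (ones k))) n 0 _ (fun a k _ hk' => ?_) (fun k _ _ => rfl)]
    · rw [prodStr, List.range_eq_range', oneStr]
      refine List.foldl_ext _ _ _ fun acc k hk' => ?_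
      have hk'' : k < n := by simpa using hk'
      rw [hYdef, litPieceF_apply n x tail j ⟨k, hk''⟩, fstF_boolPair, litStrs_eq n x j.val k j.isLt hk'']
    · have hk'' : k < n := by omega
      rw [hYdef, litPieceF_apply n x tail j ⟨k, hk''⟩, fmulOpF_apply_mod, fstF_boolPair]
  · have hk'' : k < n := by omega
    rw [hYdef, length_litPieceF n x tail j ⟨k, hk''⟩]
    simp only [ctxX, length_boolPair, (modStr_top _).1]; omega

/-- **The clause piece** on `Y`: `⟨1 + Π_k litFactor_{jk}, f⟩`. [cite: TrevisanVadhan2007, Lemma 4.1 (i)] -/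
def clausePieceF : List Bool → List Bool := fanoutFn (xorF ∘ fanoutFn (oneFrom yF) clauseProdF) yF

/-- `clausePieceF ∈ FP`. [folklore] -/
theorem clausePieceF_mem_FP : clausePieceF ∈ FP :=
  have hF : yF ∈ FP := comp_mem_FP sndF_mem_FP (comp_mem_FP sndF_mem_FP fstF_mem_FP)
  fanoutFn_mem_FP (comp_mem_FP xorF_mem_FP (fanoutFn_mem_FP (oneFrom_mem_FP hF) clauseProdF_mem_FP)) hF

/-- **Value of the clause piece**: `⟨clauseStr, f⟩`. [cite: TrevisanVadhan2007, Lemma 4.1 (i)] -/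
theorem clausePieceF_apply (n : ℕ) (x : Fin (N n) → K n) (tail : List Bool) (j : Fin n) :
    clausePieceF (boolPair (ctxX (ptBits n x ++ tail) n (modStr (Mof n))) (ones j.val)) =
      boolPair (clauseStr (Mof n) (fun k => bits (Mof n) (coordY n x j.val k)) (fun k => bits (Mof n) (coordX n x k))
        (fun k => bits (Mof n) (coordZ n x j.val k)) n) (modStr (Mof n)) := by
  have hF : yF (boolPair (ctxX (ptBits n x ++ tail) n (modStr (Mof n))) (ones j.val)) = modStr (Mof n) := by simp [yF, ctxX]
  simp only [clausePieceF, fanoutFn_apply, Function.comp_apply, hF, oneFrom_apply (Mof n) hF, clauseProdF_apply, xorF_apply,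
    clauseStr, oneStr]
  rfl

/-- Length of a product fold string: `M + 1`. [folklore] -/
theorem length_prodStr (M : ℕ) (g : ℕ → List Bool) : ∀ n, (prodStr M g n).length = M + 1
  | 0 => by simp [prodStr, oneStr]
  | n + 1 => by
    rw [prodStr, List.range_succ, List.foldl_append, List.foldl_cons, List.foldl_nil, length_fmulStr]

/-- Length of a clause string: `M + 1`. [folklore] -/
theorem length_clauseStr (M : ℕ) (ys xs zs : ℕ → List Bool) (n : ℕ) : (clauseStr M ys xs zs n).length = M + 1 := by
  rw [clauseStr, length_xorStr, oneStr, length_bits, length_prodStr, max_self]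

/-- Length of the clause piece on a genuine context: `3M + 6`. [folklore] -/
theorem length_clausePieceF (n : ℕ) (x : Fin (N n) → K n) (tail : List Bool) (j : Fin n) :
    (clausePieceF (boolPair (ctxX (ptBits n x ++ tail) n (modStr (Mof n))) (ones j.val))).length = 3 * Mof n + 6 := by
  rw [clausePieceF_apply, length_boolPair, length_clauseStr, (modStr_top _).1]; ring

/-! ### The outer fold: the matrix -/

/-- `1ⁿ` of the point context `X = ⟨P, ⟨1ⁿ, f⟩⟩`. [folklore] -/
def cN : List Bool → List Bool := fstF ∘ sndF
/-- `f` of the point context `X`. [folklore] -/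
def cF : List Bool → List Bool := sndF ∘ sndF

/-- Initialisation of the outer fold: `⟨X, ⟨encodeNat n, ⟨1⁰, 1⟩⟩⟩`. [folklore] -/
def initX : List Bool → List Bool :=
  fanoutFn (fun w => w) (fanoutFn (lenBinF ∘ cN) (fanoutFn (fun _ => []) (oneFrom cF)))

/-- `initX ∈ FP`. [folklore] -/
theorem initX_mem_FP : initX ∈ FP :=
  fanoutFn_mem_FP (PolyTimeComputable.id _) (fanoutFn_mem_FP (comp_mem_FP lenBinF_mem_FP (comp_mem_FP fstF_mem_FP sndF_mem_FP))
    (fanoutFn_mem_FP (const_mem_FP _) (oneFrom_mem_FP (comp_mem_FP sndF_mem_FP sndF_mem_FP))))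

/-- Value of `initX`. [folklore] -/
theorem initX_apply (M : ℕ) (P : List Bool) (n : ℕ) :
    initX (ctxX P n (modStr M)) = boolPair (ctxX P n (modStr M)) (boolPair (encodeNat n) (boolPair (ones 0) (bits M 1))) := by
  have hF : cF (ctxX P n (modStr M)) = modStr M := by simp [cF, ctxX]
  simp only [initX, fanoutFn_apply, Function.comp_apply, lenBinF_apply, oneFrom_apply M hF]
  simp [cN, ctxX, ones]

/-- **The matrix brick** `Π_{j<n} clause_j` on `X`: the outer counted fold. [cite: TrevisanVadhan2007, Lemma 4.1 (i)] -/
def matrixF : List Bool → List Bool := sndPow 2 ∘ foldLoop fmulOpF (clipF 3 clausePieceF) X ∘ initX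

/-- **`matrixF ∈ FP`.** [cite: TrevisanVadhan2007, Lemma 4.1 (i) ("can be evaluated in time poly(n)")] -/
theorem matrixF_mem_FP : matrixF ∈ FP :=
  comp_mem_FP (sndPow_mem_FP 2) (comp_mem_FP
    (foldLoop_clipF_mem_FP 3 fmulOpF_mem_FP length_fmulOpF_le clausePieceF_mem_FP _) initX_mem_FP)

/-- Value of the matrix brick as a string fold. [folklore] -/
theorem matrixF_apply_str (n : ℕ) (x : Fin (N n) → K n) (tail : List Bool) :
    matrixF (ctxX (ptBits n x ++ tail) n (modStr (Mof n))) =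
      matrixStr (Mof n) (fun j k => bits (Mof n) (coordY n x j k)) (fun j k => bits (Mof n) (coordZ n x j k))
        (fun k => bits (Mof n) (coordX n x k)) n := by
  set Xc := ctxX (ptBits n x ++ tail) n (modStr (Mof n)) with hXdef
  have hk : n ≤ (X : Polynomial ℕ).eval Xc.length := by
    simp only [eval_X, hXdef, ctxX, length_boolPair, ones, List.length_replicate]; omega
  have hloop := foldLoop_apply fmulOpF (clipF 3 clausePieceF) hk 0 (bits (Mof n) 1)
  rw [matrixF, Function.comp_apply, Function.comp_apply, initX_apply, hloop, sndPow_succ_boolPair, sndPow_succ_boolPair,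
    sndPow_zero_boolPair, foldAcc_clipF (fun j _ hj' => ?_)]
  · rw [foldAcc_eq_foldl fmulOpF clausePieceF Xc (fun acc p => fmulStr (Mof n) acc (fstF p))
      (fun j => clausePieceF (boolPair Xc (ones j))) n 0 _ (fun a j _ hj' => ?_) (fun j _ _ => rfl)]
    · rw [matrixStr, prodStr, List.range_eq_range', oneStr]
      refine List.foldl_ext _ _ _ fun acc j hj' => ?_
      have hj'' : j < n := by simpa using hj'
      rw [hXdef, clausePieceF_apply n x tail ⟨j, hj''⟩, fstF_boolPair]
    · have hj'' : j < n := by omega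
      rw [hXdef, clausePieceF_apply n x tail ⟨j, hj''⟩, fmulOpF_apply_mod, fstF_boolPair]
  · have hj'' : j < n := by omega
    rw [hXdef, length_clausePieceF n x tail ⟨j, hj''⟩]
    simp only [ctxX, length_boolPair, (modStr_top _).1]; omega

/-- **The matrix brick evaluates `f_{n,m(n)}`**: on the context of a point it returns the bits of the
universal matrix at the point. [cite: TrevisanVadhan2007, Lemma 4.1 (i)] -/
theorem matrixF_apply (n : ℕ) (x : Fin (N n) → K n) (tail : List Bool) :
    matrixF (ctxX (ptBits n x ++ tail) n (modStr (Mof n))) = bits (Mof n) (MvPolynomial.eval x (matrixPoly (K n) n)) := by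
  rw [matrixF_apply_str, matrixStr_eq_bits_eval]

end TVBrick

end Literature.Computability.Complexity

end
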